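import Literature.MathematicalPhysics.QuantumFieldTheory.Balaban1983to89.B6Partition118KLevelFine
import Literature.MathematicalPhysics.QuantumFieldTheory.Balaban1983to89.B6MultiLevelTorusOperator

/-!
# `Balaban1983to89.B6Partition118KLevelTorus` — T. Bałaban, *Propagators and renormalization transformations for lattice gauge theories. II*,
# Commun. Math. Phys. **96** (1984) 223–250 [Balaban1984PropagatorsII], (2.36) p. 229 with [Balaban1984PropagatorsI] (1.118) p. 36: THE SMOOTH PARTITION
# OF UNITY `{h_□}_{□∈𝒟}`, `Σ_□ h_□² = 1`, OF THE GENUINE MULTI-LEVEL COVER **ON THE TORUS `T_η`** — the PERIODIC (1.118) bumps of the active big blocks of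
# a nested family `D : TDomains`, the normalised family `h^T_□ = θ^T_□/(Σθ²)^{1/2}` and `Σ_□ h^T_□(z)² = 1` at every torus site (file 1 of route (A) of
# B6-CLOSURE §5 item 11 / GAPS G-B6-p38-04; file 2 `…B6Partition118KLevelTorusChart` is the chart dictionary, file 3 `…TorusBinders` the (2.134) binders)

statement-level skeleton of published theorems with citation tags; proofs where landed; nothing here is a claim about the Yang–Mills mass gap

PDF held: `paper:balaban1984-cmp96-propagators-rt-ii` (journal page = PDF page + 222): p. 224 [PDF 2] ((2.1): the domains are subsets of the TORUS
`T_η`), p. 229 [PDF 7] ((2.36): *"Taking these covers for all j from 0 to k we get a family 𝒟 of cubes □ … such that T_η = ⋃_{□∈𝒟} □. We construct also the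
corresponding family of functions h described in (1.118), and rescale them to proper scales. They satisfy Σ_{□∈𝒟} h_□² = 1."*), p. 239 [PDF 17] ((2.89)),
p. 247 [PDF 25] ((2.134)); [Balaban1984PropagatorsI] (1.118) p. 36 (`paper:balaban1984-cmp95-propagators-rt-i`): *"h ∈ C₀^∞(]−⅔, ⅔[), h(t) = 1 for
t ∈ [−⅓, ⅓], … Σ_n h²(t − n) = 1"* — read from the tree transcriptions in `…B6Cover236MultiLevelBlocks`, `…B6Eq238MultiLevelTorus`, `…B4PartitionUnity22`.

CITATION HEADER (lean-in-tree rule) — WHAT IS REPRODUCED.  Phase-2 file of the `lit-balaban` typed skeleton (HOME `run/shared/lean/pub/lit-balaban/`), seat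
**p38 gen 26**; SKELETON rows **B6.Eq2.36** × **B5.Eq1.118** × **B6.Eq2.91/2.134** (cells only; decls of record untouched; owner r03, referee ref-4).  Gen 25's
five files `…B6Partition118KLevelFine{,Sizes,Second,Lip,KIdx}` built `{h_□}` and its (2.134)-binders ON THE BOX (p21's `Domains`, distance (2.46) of the
fundamental box); the Prop. 2.6 assembly of record (r03's ROUTE V, `…B6GlobalChartV1`) lives ON THE TORUS, where a box cube cut by a face of the fundamental
domain is not a cube (GAPS G-B6-p38-04).  Print has no such issue: the cover (2.36) is a cover of `T_η`.  THIS FILE builds the periodic family directly: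
* §1 `circR N t = |t − N·round(t/N)|` = `dist(t, Nℤ)` for real `t` (the torus distance of one coordinate; `hprof` is even) and THE ONE-VARIABLE LEMMA
  `hprof_circR_eq`: `hprof(circR N t/(8S/5)) = hprof(t/(8S/5))` whenever `2S ≤ N`, `|t| ≤ N − S` (both sides vanish unless `|t| < N/2`, where they agree) —
  the only analytic input of the chart dictionary of file 2;
* §2 THE PERIODIC FAMILY: torus cubes = p21's active big blocks `cubes D.toDomains` (a torus site IS a site of the fundamental box; activity is chart-free),
  `thetaT c z = Π_μ hprof(circR N₀_μ(z_μ − (β_μ + ½)S_j)/(8S_j/5))`, `0 ≤ θ ≤ 1`, `θ_{own} = 1`, `nsqT = Σθ² ≥ 1`, **`hT = θ/√(Σθ²)`, `Σ_□ hT □ z² = 1`**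
  (`sum_hT_sq`, `sum_hT_mul_self` — the `hpart` shape of `…B6Eq291Generator.eq291`), `0 ≤ hT ≤ 1` (`hh1`).
No `def : Prop`, no new fact; defs with bodies (`circR`, `thetaT`, `nsqT`, `hT`); standard axioms.
HONEST SCOPE / DIVERGENCES. (1) As gen 25: the normalisation `θ/(Σθ²)^{1/2}` across adjacent levels is ours (print silent; cell divergence D-b06.38/42); the
cubes are p21's big-block-centred cubes of `…B6Cover236MultiLevelBlocks` (side `2S`, `S = M·L^j`), now periodic. (2) Integer torus `Π_μ[0, N₀_μ)`,
`N₀ = M·L^k·P`; nothing on d = 4 or the continuum; NOT summit progress.  Unit `lit-balaban-p38` (gen 26), 2026-08-23.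
-/

namespace Literature.MathematicalPhysics.QuantumFieldTheory.Balaban1983to89.B6Partition118KLevelTorus

open Finset
open Literature.MathematicalPhysics.QuantumFieldTheory.Balaban1983to89.B4Reflection242 (boxDom mem_boxDom blk)
open Literature.MathematicalPhysics.QuantumFieldTheory.Balaban1983to89.B6MultiLevelBoxOperator (Domains N0 bigSide bigSide_eq one_le_bigSide)
open Literature.MathematicalPhysics.QuantumFieldTheory.Balaban1983to89.B6MultiLevelTorusOperator (TDomains)
open Literature.MathematicalPhysics.QuantumFieldTheory.Balaban1983to89.B6Geom246MultiLevelBox (bset blkOf toR)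
open Literature.MathematicalPhysics.QuantumFieldTheory.Balaban1983to89.B6Cover236MultiLevelBlocks (cubes side side_pos ctr dist_toR_ctr_le own)
open Literature.MathematicalPhysics.QuantumFieldTheory.Balaban1983to89.B4PartitionUnity22
  (hprof hprof_neg hprof_nonneg hprof_le_one hprof_eq_one hprof_eq_zero)
open Literature.MathematicalPhysics.QuantumFieldTheory.Balaban1983to89.B6Partition118KLevelFine (blk_bigSide_eq_own)

variable {d : ℕ}

/-! ## §1  The distance to `Nℤ` of a real number and the one-variable lemma -/

/-- **`dist(t, Nℤ)`** for a real `t`: `|t − N·round(t/N)|` (the torus distance of one real coordinate; the centres of the big blocks are half-integers).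
[cite: Balaban1984PropagatorsII, (2.36) p.229 (the cover of the TORUS `T_η`), dictionary] -/
noncomputable def circR (N : ℕ) (t : ℝ) : ℝ := |t - N * round (t / N)|

/-- `dist(t, Nℤ) ≥ 0`. [cite: Balaban1984PropagatorsII, (2.36) p.229, dictionary] -/
theorem circR_nonneg (N : ℕ) (t : ℝ) : 0 ≤ circR N t := abs_nonneg _

/-- `dist(·, Nℤ)` is `N`-periodic. [cite: Balaban1984PropagatorsII, (2.36) p.229, dictionary] -/
theorem circR_add_mul {N : ℕ} (hN : 1 ≤ N) (t : ℝ) (m : ℤ) : circR N (t + N * m) = circR N t := by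
  have hN' : (0 : ℝ) < N := by exact_mod_cast hN
  unfold circR
  have e : (t + N * m) / N = t / N + m := by field_simp
  rw [e, round_add_intCast]
  push_cast
  congr 1; ring

/-- `dist(t, Nℤ) ≤ |t − N·m|` for every integer `m`. [cite: Balaban1984PropagatorsII, (2.36) p.229, dictionary] -/
theorem circR_le_abs_sub_mul {N : ℕ} (hN : 1 ≤ N) (t : ℝ) (m : ℤ) : circR N t ≤ |t - N * m| := by
  have hN' : (0 : ℝ) < N := by exact_mod_cast hN
  unfold circR
  have h := round_le (t / N) m
  have e1 : t - N * round (t / N) = N * (t / N - round (t / N)) := by field_simp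
  have e2 : t - N * m = N * (t / N - m) := by field_simp
  rw [e1, e2, abs_mul, abs_mul, abs_of_pos hN']
  exact mul_le_mul_of_nonneg_left h hN'.le

/-- `dist(t, Nℤ) ≤ |t|`. [cite: Balaban1984PropagatorsII, (2.36) p.229, dictionary] -/
theorem circR_le_abs {N : ℕ} (hN : 1 ≤ N) (t : ℝ) : circR N t ≤ |t| := by
  simpa using circR_le_abs_sub_mul hN t 0

/-- centred reals: `2|t| < N ⇒ dist(t, Nℤ) = |t|`. [cite: Balaban1984PropagatorsII, (2.36) p.229, dictionary] -/
theorem circR_of_abs_lt {N : ℕ} (hN : 1 ≤ N) {t : ℝ} (ht : 2 * |t| < N) : circR N t = |t| := by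
  have hN' : (0 : ℝ) < N := by exact_mod_cast hN
  unfold circR
  have ht' := abs_lt.1 (show |t| < N / 2 by linarith)
  have h0 : round (t / N) = 0 := by
    rw [round_eq_zero_iff]
    constructor
    · rw [le_div_iff₀ hN']; linarith
    · rw [div_lt_iff₀ hN']; linarith
  rw [h0, Int.cast_zero, mul_zero, sub_zero]

/-- for `|t| ≤ N`: `dist(t, Nℤ) ≥ min(|t|, N − |t|)`, as `N − |t| ≤ circR N t ∨ circR N t = |t|`. [cite: Balaban1984PropagatorsII, (2.36) p.229, dictionary] -/
theorem circR_ge_of_abs_le {N : ℕ} (hN : 1 ≤ N) {t : ℝ} (ht : |t| ≤ N) : (N : ℝ) - |t| ≤ circR N t ∨ circR N t = |t| := by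
  have hN' : (0 : ℝ) < N := by exact_mod_cast hN
  have ht' := abs_le.1 ht
  unfold circR
  have hr1 : round (t / N) ≤ 1 := by
    have h := round_le_add_half (t / N)
    have h1 : t / N ≤ 1 := by rw [div_le_iff₀ hN']; linarith
    have h2 : ((round (t / N) : ℤ) : ℝ) < 2 := by linarith
    have h3 : round (t / N) < 2 := by exact_mod_cast h2
    omega
  have hr2 : -1 ≤ round (t / N) := by
    have h := sub_half_lt_round (t / N)
    have h1 : -1 ≤ t / N := by rw [le_div_iff₀ hN']; linarith
    have h2 : (-2 : ℝ) < ((round (t / N) : ℤ) : ℝ) := by linarith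
    have h3 : (-2 : ℤ) < round (t / N) := by exact_mod_cast h2
    omega
  rcases (show round (t / N) = -1 ∨ round (t / N) = 0 ∨ round (t / N) = 1 by omega) with h | h | h
  · left
    rw [h, Int.cast_neg, Int.cast_one, mul_neg_one, sub_neg_eq_add, abs_of_nonneg (show (0 : ℝ) ≤ t + N by linarith)]
    linarith [neg_abs_le t]
  · right
    rw [h, Int.cast_zero, mul_zero, sub_zero]
  · left
    rw [h, Int.cast_one, mul_one, abs_of_nonpos (show t - (N : ℝ) ≤ 0 by linarith)]
    linarith [le_abs_self t]

/-- **THE ONE-VARIABLE LEMMA**: `hprof(dist(t, Nℤ)/(8S/5)) = hprof(t/(8S/5))` for `0 < S`, `2S ≤ N`, `|t| ≤ N − S` — for `2|t| < N` the two arguments have the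
same absolute value (`hprof` is even); otherwise `|t| ≥ S` and `dist(t, Nℤ) ≥ N − |t| ≥ S`, and the (1.118) profile vanishes at both.
[cite: Balaban1984PropagatorsI, (1.118) p.36 («h ∈ C₀^∞(]−⅔, ⅔[)»); Balaban1984PropagatorsII, (2.36) p.229] -/
theorem hprof_circR_eq {N : ℕ} {S t : ℝ} (hS : 0 < S) (hSN : 2 * S ≤ N) (ht : |t| ≤ N - S) :
    hprof (circR N t / (8 / 5 * S)) = hprof (t / (8 / 5 * S)) := by
  have hN1 : 1 ≤ N := by
    by_contra h
    have h0 : N = 0 := by omega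
    subst h0; simp at hSN; linarith
  have hs : (0 : ℝ) < 8 / 5 * S := by positivity
  by_cases h2 : 2 * |t| < N
  · rw [circR_of_abs_lt hN1 h2]
    rcases le_or_gt 0 t with h0 | h0
    · rw [abs_of_nonneg h0]
    · rw [abs_of_neg h0, neg_div, hprof_neg]
  · push Not at h2
    have hR : hprof (t / (8 / 5 * S)) = 0 := by
      apply hprof_eq_zero
      rw [abs_div, abs_of_pos hs, le_div_iff₀ hs]; linarith
    have hL : hprof (circR N t / (8 / 5 * S)) = 0 := by
      apply hprof_eq_zero
      rw [abs_div, abs_of_pos hs, le_div_iff₀ hs, abs_of_nonneg (circR_nonneg N t)]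
      rcases circR_ge_of_abs_le hN1 (by linarith) with h | h
      · linarith
      · rw [h]; linarith
    rw [hL, hR]

/-! ## §2  The periodic family on the torus: `θ^T_□`, `Σθ² ≥ 1`, `h^T_□ = θ^T_□/(Σθ²)^{1/2}`, `Σ_□ (h^T_□)² = 1` -/

/-- **THE PERIODIC (1.118) BUMP OF THE BIG BLOCK `c = (j, β)` ON THE TORUS `Π_μ[0, N_μ)`**: `Π_μ h(dist(z_μ − (β_μ + ½)S_j, N_μℤ)/(8S_j/5))`, `S_j = M·L^j`
(the profile of gen 25's `thetaF` composed with the torus distance of each coordinate to the centre of the big block).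
[cite: Balaban1984PropagatorsII, (2.36) p.229 («the corresponding family of functions h described in (1.118) … rescale them to proper scales»); Balaban1984PropagatorsI, (1.118) p.36] -/
noncomputable def thetaT (ℓ Mh : ℕ) (N : Fin (d + 1) → ℕ) (c : ℕ × (Fin (d + 1) → ℤ)) (z : Fin (d + 1) → ℤ) : ℝ :=
  ∏ μ, hprof (circR (N μ) ((z μ : ℝ) - ((c.2 μ : ℝ) + 1 / 2) * (bigSide ℓ Mh c.1 : ℝ)) / (8 / 5 * (bigSide ℓ Mh c.1 : ℝ)))

/-- `θ^T ≥ 0`. [cite: Balaban1984PropagatorsII, (2.36) p.229, bookkeeping] -/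
theorem thetaT_nonneg (ℓ Mh : ℕ) (N : Fin (d + 1) → ℕ) (c : ℕ × (Fin (d + 1) → ℤ)) (z : Fin (d + 1) → ℤ) : 0 ≤ thetaT ℓ Mh N c z :=
  Finset.prod_nonneg fun _ _ => hprof_nonneg _

/-- `θ^T ≤ 1`. [cite: Balaban1984PropagatorsII, (2.36) p.229, bookkeeping] -/
theorem thetaT_le_one (ℓ Mh : ℕ) (N : Fin (d + 1) → ℕ) (c : ℕ × (Fin (d + 1) → ℤ)) (z : Fin (d + 1) → ℤ) : thetaT ℓ Mh N c z ≤ 1 :=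
  Finset.prod_le_one (fun _ _ => hprof_nonneg _) fun _ _ => hprof_le_one _

section Torus

variable {ℓ Mh k R : ℕ} {P : Fin (d + 1) → ℕ} (D : TDomains d ℓ Mh k P R)

/-- **THE BUMP OF THE OWN BIG BLOCK IS `1`** at every torus site (the site is within `S/2` of the centre of its big block, in each coordinate, before and hence
after passing to the torus distance). [cite: Balaban1984PropagatorsII, p.229 («Each set Λ_j is a sum of big blocks»); Balaban1984PropagatorsI, (1.118) p.36 («h(t) = 1 for t ∈ [−⅓, ⅓]»)] -/
theorem thetaT_own_eq_one (hMh : 1 ≤ Mh) (hP : ∀ μ, 1 ≤ P μ) (z : ↥(boxDom (N0 ℓ Mh k P))) :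
    thetaT ℓ Mh (N0 ℓ Mh k P) (own D.toDomains (blkOf D.toDomains z)).1 z.1 = 1 := by
  set i := own D.toDomains (blkOf D.toDomains z) with hi
  have hS : 0 < side D.toDomains i := side_pos D.toDomains hMh i
  have hdist : dist (toR z.1) (ctr D.toDomains i) ≤ side D.toDomains i / 2 :=
    dist_toR_ctr_le D.toDomains hMh (by rw [hi]; exact blk_bigSide_eq_own D.toDomains z)
  unfold thetaT
  refine Finset.prod_eq_one fun μ _ => hprof_eq_one ?_
  have hN1 : 1 ≤ N0 ℓ Mh k P μ := B6MultiLevelTorusOperator.one_le_N0 hMh hP μ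
  have hμ := (dist_le_pi_dist (toR z.1) (ctr D.toDomains i) μ).trans hdist
  rw [Real.dist_eq] at hμ
  have eS : (bigSide ℓ Mh i.1.1 : ℝ) = side D.toDomains i := rfl
  have ec : ((i.1.2 μ : ℝ) + 1 / 2) * (bigSide ℓ Mh i.1.1 : ℝ) = ctr D.toDomains i μ := rfl
  have ez : (z.1 μ : ℝ) = toR z.1 μ := rfl
  rw [ec, eS, ez, abs_div, abs_of_pos (by positivity : (0 : ℝ) < 8 / 5 * side D.toDomains i), div_le_iff₀ (by positivity),
    abs_of_nonneg (circR_nonneg _ _)]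
  have h1 := circR_le_abs hN1 (toR z.1 μ - ctr D.toDomains i μ)
  linarith

/-- **`Σ_□ θ^T_□(z)²`** over the torus cubes (p21's active big blocks `cubes D.toDomains`: a torus site IS a site of the fundamental box, so activity needs no chart).
[cite: Balaban1984PropagatorsII, (2.36) p.229, bookkeeping] -/
noncomputable def nsqT (z : ↥(boxDom (N0 ℓ Mh k P))) : ℝ := ∑ c : ↥(cubes D.toDomains), thetaT ℓ Mh (N0 ℓ Mh k P) c.1 z.1 ^ 2

/-- `Σ_□ θ^T_□(z)² ≥ 1` (the own big block contributes `1`). [cite: Balaban1984PropagatorsII, (2.36) p.229, bookkeeping] -/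
theorem one_le_nsqT (hMh : 1 ≤ Mh) (hP : ∀ μ, 1 ≤ P μ) (z : ↥(boxDom (N0 ℓ Mh k P))) : 1 ≤ nsqT D z := by
  unfold nsqT
  calc (1 : ℝ) = thetaT ℓ Mh (N0 ℓ Mh k P) (own D.toDomains (blkOf D.toDomains z)).1 z.1 ^ 2 := by rw [thetaT_own_eq_one D hMh hP z]; norm_num
    _ ≤ ∑ c : ↥(cubes D.toDomains), thetaT ℓ Mh (N0 ℓ Mh k P) c.1 z.1 ^ 2 :=
        Finset.single_le_sum (f := fun c : ↥(cubes D.toDomains) => thetaT ℓ Mh (N0 ℓ Mh k P) c.1 z.1 ^ 2) (fun _ _ => sq_nonneg _) (Finset.mem_univ _)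

/-- `Σθ² > 0`. [cite: Balaban1984PropagatorsII, (2.36) p.229, bookkeeping] -/
theorem nsqT_pos (hMh : 1 ≤ Mh) (hP : ∀ μ, 1 ≤ P μ) (z : ↥(boxDom (N0 ℓ Mh k P))) : 0 < nsqT D z :=
  lt_of_lt_of_le one_pos (one_le_nsqT D hMh hP z)

/-- `1 ≤ (Σθ²)^{1/2}`. [cite: Balaban1984PropagatorsII, (2.36) p.229, bookkeeping] -/
theorem one_le_sqrt_nsqT (hMh : 1 ≤ Mh) (hP : ∀ μ, 1 ≤ P μ) (z : ↥(boxDom (N0 ℓ Mh k P))) : 1 ≤ Real.sqrt (nsqT D z) := by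
  rw [← Real.sqrt_one]; exact Real.sqrt_le_sqrt (one_le_nsqT D hMh hP z)

/-- **`h^T_□` ON THE TORUS**: `θ^T_□(z)/(Σ_{□′} θ^T_{□′}(z)²)^{1/2}` — the periodic partition (2.36) of `T_η`.
[cite: Balaban1984PropagatorsII, (2.36) p.229; Balaban1984PropagatorsI, (1.118) p.36] -/
noncomputable def hT (c : ↥(cubes D.toDomains)) (z : ↥(boxDom (N0 ℓ Mh k P))) : ℝ :=
  thetaT ℓ Mh (N0 ℓ Mh k P) c.1 z.1 / Real.sqrt (nsqT D z)

/-- `h^T ≥ 0`. [cite: Balaban1984PropagatorsII, (2.36) p.229, bookkeeping] -/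
theorem hT_nonneg (c : ↥(cubes D.toDomains)) (z : ↥(boxDom (N0 ℓ Mh k P))) : 0 ≤ hT D c z :=
  div_nonneg (thetaT_nonneg _ _ _ _ _) (Real.sqrt_nonneg _)

/-- `h^T_□ ≤ θ^T_□`. [cite: Balaban1984PropagatorsII, (2.36) p.229, bookkeeping] -/
theorem hT_le_thetaT (hMh : 1 ≤ Mh) (hP : ∀ μ, 1 ≤ P μ) (c : ↥(cubes D.toDomains)) (z : ↥(boxDom (N0 ℓ Mh k P))) :
    hT D c z ≤ thetaT ℓ Mh (N0 ℓ Mh k P) c.1 z.1 :=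
  div_le_self (thetaT_nonneg _ _ _ _ _) (one_le_sqrt_nsqT D hMh hP z)

/-- `h^T ≤ 1`. [cite: Balaban1984PropagatorsII, (2.36) p.229, bookkeeping] -/
theorem hT_le_one (hMh : 1 ≤ Mh) (hP : ∀ μ, 1 ≤ P μ) (c : ↥(cubes D.toDomains)) (z : ↥(boxDom (N0 ℓ Mh k P))) : hT D c z ≤ 1 :=
  (hT_le_thetaT D hMh hP c z).trans (thetaT_le_one _ _ _ _ _)

/-- `|h^T| ≤ 1` (the binder `hh1` of the (2.134) consumers). [cite: Balaban1984PropagatorsII, (2.36) p.229, (2.134) p.247] -/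
theorem abs_hT_le_one (hMh : 1 ≤ Mh) (hP : ∀ μ, 1 ≤ P μ) (c : ↥(cubes D.toDomains)) (z : ↥(boxDom (N0 ℓ Mh k P))) : |hT D c z| ≤ 1 := by
  rw [abs_of_nonneg (hT_nonneg D c z)]; exact hT_le_one D hMh hP c z

/-- **(2.36) ON THE TORUS: `Σ_{□∈𝒟} h^T_□(z)² = 1` AT EVERY SITE OF `T_η`.** [cite: Balaban1984PropagatorsII, (2.36) p.229 («They satisfy Σ_{□∈𝒟} h_□² = 1»)] -/
theorem sum_hT_sq (hMh : 1 ≤ Mh) (hP : ∀ μ, 1 ≤ P μ) (z : ↥(boxDom (N0 ℓ Mh k P))) : ∑ c, hT D c z ^ 2 = 1 := by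
  have h1 := one_le_nsqT D hMh hP z
  unfold hT
  simp_rw [div_pow]
  rw [← Finset.sum_div, Real.sq_sqrt (by linarith)]
  exact div_self (ne_of_gt (lt_of_lt_of_le one_pos h1))

/-- the same with `h·h` (the `hpart` shape of `…B6Eq291Generator.eq291`). [cite: Balaban1984PropagatorsII, (2.36) p.229, (2.91) p.239] -/
theorem sum_hT_mul_self (hMh : 1 ≤ Mh) (hP : ∀ μ, 1 ≤ P μ) (z : ↥(boxDom (N0 ℓ Mh k P))) : ∑ c, hT D c z * hT D c z = 1 := by
  simpa only [sq] using sum_hT_sq D hMh hP z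

/-- `h^T_□(z) ≠ 0 ⟹ θ^T_□(z) ≠ 0`. [cite: Balaban1984PropagatorsII, (2.36) p.229, bookkeeping] -/
theorem thetaT_ne_zero_of_hT_ne_zero {c : ↥(cubes D.toDomains)} {z : ↥(boxDom (N0 ℓ Mh k P))} (h : hT D c z ≠ 0) :
    thetaT ℓ Mh (N0 ℓ Mh k P) c.1 z.1 ≠ 0 := fun h0 => h (by unfold hT; rw [h0, zero_div])

end Torus

end Literature.MathematicalPhysics.QuantumFieldTheory.Balaban1983to89.B6Partition118KLevelTorus
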